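import Literature.NumberTheory.EllipticCurves.BertoliniLongoVenerucci2026.DefiniteGrossPeriodSelmer
import HarnessLib

/-!
# Bertolini–Longo–Venerucci, Thm. B at `χ = 𝟙` (definite, good ordinary) — the hypotheses of the REVISED text: `ρ̄_{E,p}` SURJECTIVE

ERRATUM to `DefiniteGrossPeriodSelmer.lean` (same directory).  That file's named fact
`BLV2026_card_selmerGroupPInfty_eq_pow_of_grossPeriod` transcribes Hypothesis 1.1 of
**arXiv:2306.17784v1** (2023-06-30; the corpus text `paper:arxiv-2306.17784`, chunk p0003) — curve
side "`ρ̄_{E,p}` … is irreducible", "`a_p(E) ≢ ±1 (mod p)`", "`q ∣ N⁺ ⇒ H⁰(I_{ℚ_q}, E_p) = 0`" —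
under the citation of the Math. Ann. article [BertoliniLongoVenerucci2026].  The authors' REVISED
version **arXiv:2306.17784v2** (2026-02-05, TeX file `BLV-revision.tex`; contemporaneous with the
journal publication, DOI 10.1007/s00208-026-03381-0; the journal PDF itself is the cell's
acquisition acq-10248) CHANGES the running hypothesis to the seven items quoted verbatim in the
docstring of `RevisedHypothesis` below; in particular item (3) now reads "**is surjective**", and
the Remark following Hypothesis 1.1 says: "The surjectivity of the mod `p` representation
`ρ̄_{E,p}`, as well as assumption (7), is used for the level raising results of Section 3. The
non-anomalous assumption (5) is needed for the control results of Section 5 and for the special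
value formula of Lemma 4.1. Assumption (6) simplifies the treatment of the Selmer conditions at the
primes dividing `N⁺`."  The revised §4 (theta elements `𝓛_g`, the functional `ψ_g`, Lemma 4.1)
carries its own hypothesis list with "`ρ̄_f : G_ℚ → GL₂(𝔽_p)` is surjective"; §5 (Selmer groups,
control) keeps "irreducible".  Theorem B's wording is identical in v1 and v2.  This is exactly what
the READING FLAGS RF1–RF2 of the v1 transcription pointed at (level raising and the freeness of
`J_𝔪` over `𝐓_𝔪` from Pollack–Weston's CR, which includes surjectivity): the authors now assume
surjectivity outright.

CONSEQUENCES (recorded, nothing booked here).  (i) The v1-shaped decl is NOT the published theorem;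
wherever it is taken as a hypothesis it is an UNPUBLISHED statement (the v1 generality, withdrawn
by the authors) — an explicitly OPEN hypothesis in the cell's sense, never a citation.  It cannot be
edited in place (append-only files); its deprecation is requested from the operator.  (ii) Its only
consumers, `Summits/BirchSwinnertonDyer/Rank1Residual/X9/DefiniteGrossPeriod{Route,RecordsA}.lean`
(X9 lane: curves with mod-`5` image `5S4`, NOT surjective), are withdrawn as closures: the revised
theorem meets no pair of class X9 (`not_revisedHypothesis_of_not_hasSurjectiveModNGaloisRep`).
(iii) This file carries the correctly transcribed statement, for whichever lane has SURJECTIVE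
consumers.  Evidence (verbatim TeX of both versions with line numbers, the arXiv API record, sha256
of the e-prints): `run/shared/lean/b2b/bsd-rank1-residual/b2b-bsdres-x9/g26/BLV-v1-v2-HYPOTHESES.md`.

HONEST FRAMING (cell `b2b-bsdres`): published theorems are cited verbatim with their hypotheses;
class X9 stays TYPED at class level; this file introduces no class statement and closes nothing.

Typing: exactly the dictionary of `DefiniteGrossPeriodSelmer.lean` (module docstring there; the
quaternionic side = the tree's Kim-2024 toric-period template of `BipartiteToricPeriod.lean`), with
two additions for the revised items: "`p` inert / split in `K`" as `#primesOver (p) = 1 / 2`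
(`p ∤ d_K` by item (2)), and "`H⁰(G_{ℚ_q}, E_p) = 0`" via the decomposition groups
`𝔓.decompositionSubgroup Γ_ℚ` (`IntegralGaloisAction.lean`) at primes `𝔓 ∣ q` of `ℤ̄`.

## References

* [BertoliniLongoVenerucci2026] M. Bertolini, M. Longo, R. Venerucci, *The anticyclotomic main
  conjectures for elliptic curves*, Math. Ann. (2026), doi:10.1007/s00208-026-03381-0; revised text
  arXiv:2306.17784v2 (2026-02-05): Hypothesis 1.1 and the Remark after it, §4 (hypothesis list,
  Lemma 4.1), Thm. 7.1, §9.2 Step 1, Theorem B.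
* [BertoliniLongoVenerucci2023] arXiv:2306.17784v1 (the superseded text transcribed next door).
* [PollackWeston2011] Compos. Math. 147 (2011), hypothesis CR; [Kim2024] (typing template).
-/

namespace Literature.NumberTheory.EllipticCurves.BertoliniLongoVenerucci2026

open scoped BigOperators NumberField Pointwise
open Literature.NumberTheory.GaloisRepresentations

/-- **Hypothesis 1.1 of the revised text, items (1)–(7), in the definite good-ordinary case** — the
curve/field side of Theorem B as the authors now state it.  Verbatim (arXiv:2306.17784v2): "(1) The
rational prime `p` is `⩾ 5` and does not divide `N`. (2) The rational prime `p` does not divide the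
class number `h_K` and the discriminant of `K`. (3) The representation `ρ̄_{E,p} : G_ℚ → GL₂(𝔽_p)`
arising from the `p`-torsion `E(ℚ̄)_p` of `E` is surjective. (4) `N⁻` is squarefree. (5) If `E` has
good ordinary reduction at `p`, then `a_p(E) ≢ ±1 (mod p)` if `p` is inert in `K`, and
`a_p(E) ≢ 1 (mod p)` if `p` splits in `K`. (6) If `q` is a prime dividing `N⁺`, then
`H⁰(G_{ℚ_q}, E_p) = 0` and `ρ̄_{E,p}` is ramified at `q`. (7) If `q ∥ N⁻` and `q ≡ ±1 (mod p)`,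
then `ρ̄_{E,p}` is ramified at `q`."  with "Let `N` be as above the conductor of `E`, assumed to be
coprime with the discriminant of `K`. Factor `N` as `N = N⁺N⁻`, where `N⁺` resp. `N⁻` is divisible
only by primes which are split, resp. inert in `K`", the DEFINITE case "`N⁻` has an odd number of
prime divisors", and the good ORDINARY case at `p` (`ε = ∅`).  Conjuncts, in order: (1) + ordinary;
`K` imaginary quadratic with `(d_K, N·p) = 1` and (2); (3) = `HasSurjectiveModNGaloisRep`;
factorisation + (4) + definite + split/inert; (5); (6) (fixed points of a decomposition group
`𝔓.decompositionSubgroup Γ_ℚ`, `𝔓 ∣ q`, are `0`; some inertia element at `q` moves a point of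
`E[p](ℚ̄)`); (7).
[cite: BertoliniLongoVenerucci2026, Hypothesis 1.1 (1)–(7) and the following Remark (revised text arXiv:2306.17784v2, 2026-02-05)] -/
def RevisedHypothesis (W : WeierstrassCurve ℚ) [W.IsElliptic] [W.IsGloballyMinimal] (p : ℕ)
    [Fact p.Prime] (K : Type) [Field K] [NumberField K] (Nplus Nminus : ℕ) : Prop :=
  (5 ≤ p ∧ W.HasGoodReductionAtPrime p ∧ ¬ (p : ℤ) ∣ W.frobeniusTrace p) ∧
  (Module.finrank ℚ K = 2 ∧ NumberField.IsTotallyComplex K ∧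
    Int.gcd (NumberField.discr K) (W.conductorNorm ℤ * p) = 1 ∧
    ¬ p ∣ Fintype.card (ClassGroup (NumberField.RingOfIntegers K))) ∧
  W.HasSurjectiveModNGaloisRep (p : ℤ) ∧
  (W.conductorNorm ℤ = Nplus * Nminus ∧ Nat.Coprime Nplus Nminus ∧ Squarefree Nminus ∧
    Odd Nminus.primeFactors.card ∧
    (∀ q : ℕ, q.Prime → q ∣ Nplus →
      ((Ideal.span {(q : ℤ)}).primesOver (NumberField.RingOfIntegers K)).ncard = 2) ∧
    (∀ q : ℕ, q.Prime → q ∣ Nminus →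
      ((Ideal.span {(q : ℤ)}).primesOver (NumberField.RingOfIntegers K)).ncard = 1)) ∧
  ((((Ideal.span {(p : ℤ)}).primesOver (NumberField.RingOfIntegers K)).ncard = 1 →
      ¬ (p : ℤ) ∣ W.frobeniusTrace p - 1 ∧ ¬ (p : ℤ) ∣ W.frobeniusTrace p + 1) ∧
    (((Ideal.span {(p : ℤ)}).primesOver (NumberField.RingOfIntegers K)).ncard = 2 →
      ¬ (p : ℤ) ∣ W.frobeniusTrace p - 1)) ∧
  (∀ q : ℕ, q.Prime → q ∣ Nplus →
    (∀ v : IsDedekindDomain.HeightOneSpectrum (𝓞 ℚ), ((q : ℕ) : 𝓞 ℚ) ∈ v.asIdeal →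
      ∀ 𝔓 ∈ v.primesAbove, ∀ P : W.geomTorsion (p : ℤ),
        (∀ σ ∈ 𝔓.decompositionSubgroup (Field.absoluteGaloisGroup ℚ), σ • P = P) → P = 0) ∧
    (∃ v : IsDedekindDomain.HeightOneSpectrum (𝓞 ℚ), ((q : ℕ) : 𝓞 ℚ) ∈ v.asIdeal ∧
      ∃ 𝔓 ∈ v.primesAbove, ∃ σ ∈ 𝔓.inertia (Field.absoluteGaloisGroup ℚ),
        ∃ P : W.geomTorsion (p : ℤ), σ • P ≠ P)) ∧
  (∀ q : ℕ, q.Prime → q ∣ Nminus → ((p : ℤ) ∣ (q : ℤ) - 1 ∨ (p : ℤ) ∣ (q : ℤ) + 1) →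
    ∃ v : IsDedekindDomain.HeightOneSpectrum (𝓞 ℚ), ((q : ℕ) : 𝓞 ℚ) ∈ v.asIdeal ∧
      ∃ 𝔓 ∈ v.primesAbove, ∃ σ ∈ 𝔓.inertia (Field.absoluteGaloisGroup ℚ),
        ∃ P : W.geomTorsion (p : ℤ), σ • P ≠ P)

/-- Item (3) of the revised Hypothesis 1.1: `ρ̄_{E,p}` is surjective.
[cite: BertoliniLongoVenerucci2026, Hypothesis 1.1 (3) (revised text)] -/
theorem RevisedHypothesis.hasSurjectiveModNGaloisRep {W : WeierstrassCurve ℚ} [W.IsElliptic]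
    [W.IsGloballyMinimal] {p : ℕ} [Fact p.Prime] {K : Type} [Field K] [NumberField K]
    {Nplus Nminus : ℕ} (h : RevisedHypothesis W p K Nplus Nminus) :
    W.HasSurjectiveModNGaloisRep (p : ℤ) :=
  h.2.2.1

/-- **The revised hypothesis fails for every curve whose mod-`p` representation is not
surjective** — in particular for every pair of the cell's class X9 and for the five `5S4` curves of
`X9/DefiniteGrossPeriodRecordsA.lean`. [cite: BertoliniLongoVenerucci2026, Hypothesis 1.1 (3) (revised text)] -/
theorem not_revisedHypothesis_of_not_hasSurjectiveModNGaloisRep {W : WeierstrassCurve ℚ}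
    [W.IsElliptic] [W.IsGloballyMinimal] {p : ℕ} [Fact p.Prime] (K : Type) [Field K]
    [NumberField K] (Nplus Nminus : ℕ) (h : ¬ W.HasSurjectiveModNGaloisRep (p : ℤ)) :
    ¬ RevisedHypothesis W p K Nplus Nminus :=
  fun hR => h hR.hasSurjectiveModNGaloisRep

/-- **The quaternionic data and the conductor-`1` Gross point of Theorem B's Gross-point form** — the
conjuncts of `BLV2026_card_selmerGroupPInfty_eq_pow_of_grossPeriod` after its curve/field side,
VERBATIM (they do not depend on the v1/v2 difference): `B = (a,b)_ℚ` definite, a division algebra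
at `q` iff `q ∣ N⁻`; `O = O₁ ⊓ O₂` an Eichler order of level `N⁺` (two maximal orders, `[O₁ : O] =
N⁺`); `RI` the invertible right `O`-ideals; `IsEig` = `B^×`-invariance + the Hecke eigen-equations
`T_q g = a_q(E)·g` (`q ∤ N`); `φ : RI → ℤ` an `IsEig` functional, non-zero, generating the ℤ-module
of `IsEig` functionals (the primitive integral `f`-eigenfunctional `ψ_f`, §4.1–4.2); `(ψ, I, rep)`:
`ψ : K → B` with `ψ(𝒪_K) I ⊆ I` optimally (a Gross point of conductor `1`, §2.4 with `n = 0`) and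
ideal-class representatives `rep` (the `Pic(𝒪_K)`-orbit, §2.4 "`g f̂(𝔞) × f`").  Dictionary and
sources: module docstring of `DefiniteGrossPeriodSelmer.lean` and of `BipartiteToricPeriod.lean`.
[cite: BertoliniLongoVenerucci2026, §2.1–2.5 (Gross curve `X_{N⁺,N⁻}`, `J_{N⁺,N⁻}`, Hecke operators, Gross points `P_K`), §4.1–4.2 (`ψ_g`)] -/
def GrossPointData (W : WeierstrassCurve ℚ) [W.IsElliptic] [W.IsGloballyMinimal]
    (Nplus Nminus : ℕ) (a b : ℚ)
    (O : Subring (QuaternionAlgebra ℚ a 0 b)) (K : Type) [Field K] [NumberField K]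
    (ψ : K →ₐ[ℚ] QuaternionAlgebra ℚ a 0 b) (I : Submodule ℤ (QuaternionAlgebra ℚ a 0 b))
    (φ : Submodule ℤ (QuaternionAlgebra ℚ a 0 b) → ℤ)
    (rep : ClassGroup (NumberField.RingOfIntegers K) →
      nonZeroDivisors (Ideal (NumberField.RingOfIntegers K)))
    (RI : Set (Submodule ℤ (QuaternionAlgebra ℚ a 0 b)))
    (IsEig : (Submodule ℤ (QuaternionAlgebra ℚ a 0 b) → ℤ) → Prop) : Prop :=
  (a < 0 ∧ b < 0 ∧ (∀ (q : ℕ) [Fact q.Prime],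
    (∀ x : QuaternionAlgebra ℚ_[q] (a : ℚ_[q]) 0 (b : ℚ_[q]), x ≠ 0 → IsUnit x) ↔ q ∣ Nminus)) ∧
  (∃ O₁ O₂ : Subring (QuaternionAlgebra ℚ a 0 b), (∀ S : Subring (QuaternionAlgebra ℚ a 0 b),
    (S = O₁ ∨ S = O₂) → (S.toAddSubgroup.FG ∧ (∀ d : QuaternionAlgebra ℚ a 0 b, ∃ m : ℤ, m ≠ 0 ∧
    m • d ∈ S) ∧ ∀ S' : Subring (QuaternionAlgebra ℚ a 0 b), S'.toAddSubgroup.FG → S ≤ S' →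
    S' = S)) ∧ O = O₁ ⊓ O₂ ∧ O.toAddSubgroup.relIndex O₁.toAddSubgroup = Nplus) ∧
  ((∀ J : Submodule ℤ (QuaternionAlgebra ℚ a 0 b), J ∈ RI ↔ (J.FG ∧ (∀ d : QuaternionAlgebra ℚ
    a 0 b, ∃ m : ℤ, m ≠ 0 ∧ m • d ∈ J) ∧ (∀ x : QuaternionAlgebra ℚ a 0 b, (∀ y ∈ J, y * x ∈ J)
    ↔ x ∈ O) ∧ (∃ J' : Submodule ℤ (QuaternionAlgebra ℚ a 0 b), (∀ x : QuaternionAlgebra ℚ a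
    0 b, x ∈ J * J' ↔ ∀ y ∈ J, x * y ∈ J) ∧ (∀ x : QuaternionAlgebra ℚ a 0 b, x ∈ J' * J ↔ x ∈
    O)))) ∧ (∀ g : Submodule ℤ (QuaternionAlgebra ℚ a 0 b) → ℤ, IsEig g ↔ ((∀ J ∈ RI, ∀ β :
    QuaternionAlgebra ℚ a 0 b, IsUnit β → g (J.map (AddMonoidHom.mulLeft β).toIntLinearMap) =
    g J) ∧ (∀ q : ℕ, q.Prime → ¬ q ∣ W.conductorNorm ℤ → ∀ J ∈ RI, ∑ᶠ J' ∈ {J' : Submodule ℤ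
    (QuaternionAlgebra ℚ a 0 b) | J' ≤ J ∧ J'.toAddSubgroup.relIndex J.toAddSubgroup = q ^ 2 ∧
    ∀ y ∈ J', ∀ x ∈ O, y * x ∈ J'}, g J' = (W.frobeniusTrace q : ℤ) * g J))) ∧ IsEig φ ∧
    (∃ J ∈ RI, φ J ≠ 0) ∧ (∀ g : Submodule ℤ (QuaternionAlgebra ℚ a 0 b) → ℤ, IsEig g →
    ∃ u : ℤ, ∀ J ∈ RI, g J = u * φ J)) ∧
  (I ∈ RI ∧ (∀ x : NumberField.RingOfIntegers K, ∀ y ∈ I, ψ (x : K) * y ∈ I) ∧ (∀ x : K, (∀ y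
    ∈ I, ψ x * y ∈ I) → ∃ z : NumberField.RingOfIntegers K, (z : K) = x) ∧ (∀ 𝔞 : ClassGroup
    (NumberField.RingOfIntegers K), ClassGroup.mk0 (rep 𝔞) = 𝔞))

/-- The Gross period `S = ψ_f(P_K) = Σ_{[𝔞] ∈ Cl_K} φ(ψ(rep 𝔞)·I)` of the data — the integer whose
`p`-adic valuation Theorem B reads (`P_K = Σ_{σ ∈ Pic(𝒪_K)} σ(P̃₀)`, §2.5).
[cite: BertoliniLongoVenerucci2026, §2.5 (the divisor `P_K`) and Lemma 4.1 (`𝓛_g(𝟙) = ψ_g(P_K)` up to a unit)] -/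
noncomputable def grossPeriod {a b : ℚ} (K : Type) [Field K] [NumberField K]
    (ψ : K →ₐ[ℚ] QuaternionAlgebra ℚ a 0 b) (I : Submodule ℤ (QuaternionAlgebra ℚ a 0 b))
    (φ : Submodule ℤ (QuaternionAlgebra ℚ a 0 b) → ℤ)
    (rep : ClassGroup (NumberField.RingOfIntegers K) →
      nonZeroDivisors (Ideal (NumberField.RingOfIntegers K))) : ℤ :=
  ∑ 𝔞 : ClassGroup (NumberField.RingOfIntegers K), φ (Submodule.span ℤ ((fun x :
    NumberField.RingOfIntegers K => ψ (x : K)) '' ((rep 𝔞 : nonZeroDivisors (Ideal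
    (NumberField.RingOfIntegers K))) : Ideal (NumberField.RingOfIntegers K))) * I)

/-- **Bertolini–Longo–Venerucci, Theorem B at `χ = 𝟙` in the definite good-ordinary case,
Gross-point form, with the hypotheses of the REVISED text** (supersedes the v1-shaped
`BLV2026_card_selmerGroupPInfty_eq_pow_of_grossPeriod`): under `RevisedHypothesis W p K N⁺ N⁻`
(in particular `ρ̄_{E,p}` SURJECTIVE) and `GrossPointData`, if `S = ψ_f(P_K) ≠ 0` then
`#Sel_{p^∞}(E/K) = p^{2·ord_p S}`.  Printed: Thm. B "Let `χ` be a finite order character of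
conductor `p^n` of the Galois group of `K_∞/K`. Then `Sel(K,A_f(χ))` is finite if and only if
`L(E/K,χ,1) ≠ 0`. In this case one has `length_{𝒪_χ}(Sel(K,A_f(χ))) ⩽ ord_χ(L(E/K,χ,1)/C)` with
equality in the non-exceptional case" (the good ordinary case is never exceptional, Def. 1.2);
§9.2 Step 1 "`length_{𝒪_χ}(Sel(K,A_f(χ))) = … = 2·ord_χ(𝓛_{f,n}(χ̄))`" (Thm. 7.1); Lemma 4.1
"`𝓛_g(𝟙) = ψ_g(P_K(L))` … up to multiplication by an element in `R^*`" (its unit factors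
`(1 − α_p)²` at split `p`, `1 − α_p²` at inert `p` are exactly item (5)); here `n = 0`, `χ = 𝟙`,
`k = ∞`, `L = 1`, `g = f`, `R = ℤ_p`, `A_f(𝔓_𝟙) ≅ E[p^∞]`, `Sel(K, A_f) = Sel_{p^∞}(E/K)` (the
reading steps (i)–(ii) recorded in `DefiniteGrossPeriodSelmer.lean` are unchanged).
[cite: BertoliniLongoVenerucci2026, Thm. B with Hypothesis 1.1 of the revised text (arXiv:2306.17784v2), Thm. 7.1, Lemma 4.1, §9.2 Step 1, §2.4–2.5] -/
def BLV2026_card_selmerGroupPInfty_eq_pow_of_grossPeriod_of_surjective : Prop :=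
    ∀ (W : WeierstrassCurve ℚ) [W.IsElliptic] [W.IsGloballyMinimal] (p : ℕ) [Fact p.Prime] (Nplus
      Nminus : ℕ) (a b : ℚ) (O : Subring (QuaternionAlgebra ℚ a 0 b)) (K : Type) [Field K]
      [NumberField K] (ψ : K →ₐ[ℚ] QuaternionAlgebra ℚ a 0 b) (I : Submodule ℤ (QuaternionAlgebra ℚ
      a 0 b)) (φ : Submodule ℤ (QuaternionAlgebra ℚ a 0 b) → ℤ) (rep : ClassGroup
      (NumberField.RingOfIntegers K) → nonZeroDivisors (Ideal (NumberField.RingOfIntegers K))) (RI :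
      Set (Submodule ℤ (QuaternionAlgebra ℚ a 0 b))) (IsEig : (Submodule ℤ (QuaternionAlgebra ℚ a 0
      b) → ℤ) → Prop),
      RevisedHypothesis W p K Nplus Nminus →
      GrossPointData W Nplus Nminus a b O K ψ I φ rep RI IsEig →
      grossPeriod K ψ I φ rep ≠ 0 →
      Nat.card ((W.baseChange K).selmerGroupPInfty p) =
        p ^ (2 * padicValInt p (grossPeriod K ψ I φ rep))

/-- **The unit case of the revised statement: `p ∤ ψ_f(P_K) ⟹ Sel_{p^∞}(E/K) = 0`** (PROVED from
the fact `…_of_surjective`: the exponent `2·ord_p S` is `0`, so the Selmer group has one element).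
[cite: BertoliniLongoVenerucci2026, Thm. B (n = 0) with Hypothesis 1.1 of the revised text] -/
theorem selmerGroupPInfty_baseChange_eq_bot_of_BLV2026_of_surjective
    (h : BLV2026_card_selmerGroupPInfty_eq_pow_of_grossPeriod_of_surjective)
    (W : WeierstrassCurve ℚ) [W.IsElliptic] [W.IsGloballyMinimal] (p : ℕ) [Fact p.Prime] (Nplus
      Nminus : ℕ) (a b : ℚ) (O : Subring (QuaternionAlgebra ℚ a 0 b)) (K : Type) [Field K]
      [NumberField K] (ψ : K →ₐ[ℚ] QuaternionAlgebra ℚ a 0 b) (I : Submodule ℤ (QuaternionAlgebra ℚ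
      a 0 b)) (φ : Submodule ℤ (QuaternionAlgebra ℚ a 0 b) → ℤ) (rep : ClassGroup
      (NumberField.RingOfIntegers K) → nonZeroDivisors (Ideal (NumberField.RingOfIntegers K))) (RI :
      Set (Submodule ℤ (QuaternionAlgebra ℚ a 0 b))) (IsEig : (Submodule ℤ (QuaternionAlgebra ℚ a 0
      b) → ℤ) → Prop)
    (hyp : RevisedHypothesis W p K Nplus Nminus)
    (hdata : GrossPointData W Nplus Nminus a b O K ψ I φ rep RI IsEig)
    (hunit : ¬ (p : ℤ) ∣ grossPeriod K ψ I φ rep) :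
    (W.baseChange K).selmerGroupPInfty p = ⊥ := by
  have hS0 : grossPeriod K ψ I φ rep ≠ 0 := fun h0 => hunit (by rw [h0]; exact dvd_zero _)
  have hcard := h W p Nplus Nminus a b O K ψ I φ rep RI IsEig hyp hdata hS0
  have hv : padicValInt p (grossPeriod K ψ I φ rep) = 0 := by
    rw [padicValInt, padicValNat.eq_zero_of_not_dvd]
    rw [← Int.natCast_dvd]
    exact hunit
  rw [hv, mul_zero, pow_zero] at hcard
  exact AddSubgroup.eq_bot_of_card_eq _ hcard

end Literature.NumberTheory.EllipticCurves.BertoliniLongoVenerucci2026
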